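import Mathlib
import HarnessLib

/-!
# Associative–commutative rearrangement within a finite universe of terms

The *universe* cost measure of equational reasoning modulo associativity and commutativity
(AC), the AC analogue of the measure `ℓ` (number of distinct subformulas of a proof) for Frege
systems and of Krajíček's provability relation "within a set `Γ`" of formulas.

* `ACRewriting.subterms t` — the finite set of subterms of a term `t : FreeAddMagma α` (binary
  trees over one binary symbol `+` with leaves in `α`); `ACRewriting.SubtermClosed Δ`.
* `ACRewriting.Derives Δ s t` (`s ~_Δ t`) — the least equivalence relation on the finite set
  `Δ` of terms closed under the instances of commutativity `s + t ~ t + s`, associativity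
  `(s + t) + u ~ s + (t + u)` and congruence `s₁ ~ t₁, s₂ ~ t₂ ⊢ s₁ + s₂ ~ t₁ + t₂` BOTH OF WHOSE
  SIDES LIE IN `Δ`: a derivation in the pure AC equational calculus all of whose terms belong to
  `Δ` — the term-rewriting rendering of Krajíček's `⊢_Γ` ("provable by a proof all of whose
  formulas are in `Γ`", Def. 13.3.1) for the equational theory AC in place of a Frege system.
* `ACRewriting.Closes Δ s t` — `Δ` is subterm-closed and `s ~_Δ t`; `ACRewriting.Congruent s t` —
  some finite subterm-closed `Δ` closes `s ~ t`; `ACRewriting.minUniverse s t` — the least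
  cardinality of such a `Δ` (the universe cost `U(s, t)`; `sInf`, value `0` iff no `Δ` closes).
* `ACRewriting.comb l z` — the right comb `a₁ + (a₂ + (⋯ + (a_k + z)))` over the leaves `l` with
  terminal subtree `z`; `ACRewriting.combPerm π` — the right comb
  `x_{π 0} + (x_{π 1} + (⋯ + x_{π n}))` of a permutation `π` of `Fin (n + 1)`;
  `ACRewriting.acUniverse π := minUniverse (combPerm 1) (combPerm π)` — the AC-REARRANGEMENT
  UNIVERSE `U_AC(π)`: the least number of distinct terms of an AC-derivation re-bracketing and
  re-ordering the generic sum `x₀ + (x₁ + (⋯ + x_n))` into the order `π`.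
* Proved here: both sides of a derivation lie in `Δ` (`Derives.mem`), monotonicity in `Δ`
  (`Derives.mono`), `Congruent` is a congruence for `+` containing commutativity and
  associativity, right combs over permuted leaf sequences are congruent (`congruent_comb_of_perm`,
  `congruent_combPerm`), hence every `acUniverse π` is attained by an actual closing universe
  (`exists_card_eq_acUniverse`: the `sInf` is never the junk value) and is bounded by the
  cardinality of any closing universe (`acUniverse_le_card`).

Semantics (not formalised here): every node of `Δ` computes the multiset of its leaves, so a
subterm-closed `Δ` is a set-union straight-line program and `~_Δ` walks through ordered splits of
equal multisets both halves of which are computed by `Δ`; `U_AC` is thus a dag-like, search-order-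
free cost of re-bracketing, the object of the hub route `FregeLinesACUniverse` (sub-problem `PneNP`),
whose cruxes assert `U_AC(π) = Ω(N log N)` for some permutations (a lower bound for set-union
straight-line programs) and compare `U_AC` with the number of LINES of Frege proofs of
permutation-parity tautologies (`PermutationParityTautologies.lean`). The measure itself — least
number of distinct sub-objects of a derivation, derivability inside a prescribed finite set — is
Krajíček's (`ℓ`, Def. 4.4.3 and Lemma 4.4.6; `⊢_Γ`, Def. 13.3.1); its specialisation to the AC
calculus and the name `U_AC` are this library's choice and are not claimed to appear in print.

## Sources

* J. Krajíček, *Bounded Arithmetic, Propositional Logic, and Complexity Theory* (CUP 1995):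
  Def. 4.4.3 (the measure `ℓ` = number of distinct subformulas), Lemma 4.4.6, Def. 13.3.1
  (`⊢_Γ`, provability within a set of formulas), Thm. 13.3.6.
* P. Pudlák, S. Buss, *How to lie without being (easily) convicted and the lengths of proofs in
  propositional calculus*, CSL '94 (1995), §4 (permutation tautologies, Orevkov's rearrangement
  lower bound for tree-like Frege proofs).

## Design choices

* Terms are Mathlib's `FreeAddMagma α` (binary trees, one binary operation `+`, no unit, no laws);
  repeated leaves are allowed in a universe. Finite universes are `Finset`s; the rules of `Derives`
  carry the membership side conditions explicitly, so no decidability is needed to STATE them.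
* `minUniverse`/`acUniverse` are `sInf`s over `ℕ` (`noncomputable`); attainment is a theorem
  (`exists_card_eq_acUniverse`), proved by an explicit congruence argument (bubble the leaves:
  `Congruent` is a congruence containing the AC instances, and right combs over permuted leaf
  lists are congruent), not by a size bound.
* Mathlib has `FreeAddMagma`, `FreeAddSemigroup`, `Equiv.Perm`, `List.Perm`, but no rewriting
  derivations restricted to a finite set of terms and no proof-complexity measure for equational
  calculi (searched `FreeMagma`, `Rewriting`, `EqvGen`, `universe`).
-/

namespace Literature.Computability.MetaComplexity

namespace ACRewriting

open FreeAddMagma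

universe u

variable {α : Type u}

section Derivations

/-- `Derives Δ s t` (`s ~_Δ t`): `s = t` is derivable in the pure associative–commutative
equational calculus by a derivation ALL OF WHOSE TERMS LIE IN THE FINITE SET `Δ` — the least
equivalence relation on `Δ` closed under the instances of commutativity, associativity and
congruence both of whose sides belong to `Δ` (Krajíček's provability `⊢_Γ` within a set `Γ`,
for the equational theory AC). [cite: Krajicek1995, Def 13.3.1 (provability within a set Γ), adapted to the AC equational calculus] -/
inductive Derives (Δ : Finset (FreeAddMagma α)) : FreeAddMagma α → FreeAddMagma α → Prop
  /-- reflexivity, on members of `Δ` only -/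
  | refl {t : FreeAddMagma α} : t ∈ Δ → Derives Δ t t
  /-- symmetry -/
  | symm {s t : FreeAddMagma α} : Derives Δ s t → Derives Δ t s
  /-- transitivity -/
  | trans {s t u : FreeAddMagma α} : Derives Δ s t → Derives Δ t u → Derives Δ s u
  /-- an instance of commutativity with both sides in `Δ` -/
  | comm {s t : FreeAddMagma α} : s + t ∈ Δ → t + s ∈ Δ → Derives Δ (s + t) (t + s)
  /-- an instance of associativity with both sides in `Δ` -/
  | assoc {s t u : FreeAddMagma α} :
      s + t + u ∈ Δ → s + (t + u) ∈ Δ → Derives Δ (s + t + u) (s + (t + u))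
  /-- congruence, with both compound sides in `Δ` -/
  | cong {s₁ t₁ s₂ t₂ : FreeAddMagma α} : Derives Δ s₁ t₁ → Derives Δ s₂ t₂ →
      s₁ + s₂ ∈ Δ → t₁ + t₂ ∈ Δ → Derives Δ (s₁ + s₂) (t₁ + t₂)

variable {Δ Δ' : Finset (FreeAddMagma α)} {s t u : FreeAddMagma α}

/-- Both sides of a derivation within `Δ` belong to `Δ`. [cite: Krajicek1995, Def 13.3.1] -/
theorem Derives.mem (h : Derives Δ s t) : s ∈ Δ ∧ t ∈ Δ := by
  induction h with
  | refl h => exact ⟨h, h⟩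
  | symm _ ih => exact ih.symm
  | trans _ _ ih₁ ih₂ => exact ⟨ih₁.1, ih₂.2⟩
  | comm h₁ h₂ => exact ⟨h₁, h₂⟩
  | assoc h₁ h₂ => exact ⟨h₁, h₂⟩
  | cong _ _ h₁ h₂ _ _ => exact ⟨h₁, h₂⟩

/-- Derivability within a set is monotone in the set. [cite: Krajicek1995, Def 13.3.1] -/
theorem Derives.mono (h : Derives Δ s t) (hΔ : Δ ⊆ Δ') : Derives Δ' s t := by
  induction h with
  | refl h => exact .refl (hΔ h)
  | symm _ ih => exact ih.symm
  | trans _ _ ih₁ ih₂ => exact ih₁.trans ih₂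
  | comm h₁ h₂ => exact .comm (hΔ h₁) (hΔ h₂)
  | assoc h₁ h₂ => exact .assoc (hΔ h₁) (hΔ h₂)
  | cong _ _ h₁ h₂ ih₁ ih₂ => exact .cong ih₁ ih₂ (hΔ h₁) (hΔ h₂)

end Derivations

section Universes

variable [DecidableEq α]

/-- The finite set of subterms of a term (the term itself included).
[cite: Krajicek1995, Def 4.4.3 (subformulas; the measure ℓ)] -/
def subterms : FreeAddMagma α → Finset (FreeAddMagma α)
  | FreeAddMagma.of a => {FreeAddMagma.of a}
  | x + y => insert (x + y) (subterms x ∪ subterms y)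

/-- A term is a subterm of itself. [cite: Krajicek1995, Def 4.4.3] -/
theorem self_mem_subterms (t : FreeAddMagma α) : t ∈ subterms t := by
  induction t with
  | ih1 a => simp [subterms]
  | ih2 x y _ _ => simp [subterms]

/-- The two immediate subterms of `x + y` are subterms. [cite: Krajicek1995, Def 4.4.3] -/
theorem subterms_add (x y : FreeAddMagma α) :
    subterms (x + y) = insert (x + y) (subterms x ∪ subterms y) := by
  simp [subterms]

/-- Subterms of subterms are subterms. [cite: Krajicek1995, Def 4.4.3] -/
theorem subterms_subset_of_mem {u t : FreeAddMagma α} (h : u ∈ subterms t) :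
    subterms u ⊆ subterms t := by
  induction t with
  | ih1 a =>
    simp only [subterms, Finset.mem_singleton] at h
    subst h
    simp [subterms]
  | ih2 x y ihx ihy =>
    rw [subterms_add, Finset.mem_insert, Finset.mem_union] at h
    rcases h with rfl | h | h
    · rw [subterms_add]
    · exact (ihx h).trans
        (fun v hv => by rw [subterms_add]; exact Finset.mem_insert_of_mem (Finset.mem_union_left _ hv))
    · exact (ihy h).trans
        (fun v hv => by rw [subterms_add]; exact Finset.mem_insert_of_mem (Finset.mem_union_right _ hv))

/-- `SubtermClosed Δ`: the finite universe `Δ` contains, with every term, all its subterms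
(Krajíček's "set closed under subformulas"). [cite: Krajicek1995, Def 13.3.1] -/
def SubtermClosed (Δ : Finset (FreeAddMagma α)) : Prop :=
  ∀ t ∈ Δ, subterms t ⊆ Δ

/-- The set of subterms of a term is subterm-closed. [cite: Krajicek1995, Def 4.4.3] -/
theorem subtermClosed_subterms (t : FreeAddMagma α) : SubtermClosed (subterms t) :=
  fun _ hu => subterms_subset_of_mem hu

/-- Subterm-closed sets are closed under union. [cite: Krajicek1995, Def 13.3.1] -/
theorem SubtermClosed.union {Δ₁ Δ₂ : Finset (FreeAddMagma α)} (h₁ : SubtermClosed Δ₁)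
    (h₂ : SubtermClosed Δ₂) : SubtermClosed (Δ₁ ∪ Δ₂) := by
  intro t ht
  rcases Finset.mem_union.mp ht with ht | ht
  · exact (h₁ t ht).trans Finset.subset_union_left
  · exact (h₂ t ht).trans Finset.subset_union_right

/-- `Closes Δ s t`: the finite universe `Δ` is subterm-closed and `s ~_Δ t` — `Δ` is a universe
CLOSING the identity `s = t` in the AC calculus. [cite: Krajicek1995, Def 13.3.1] -/
def Closes (Δ : Finset (FreeAddMagma α)) (s t : FreeAddMagma α) : Prop :=
  SubtermClosed Δ ∧ Derives Δ s t

/-- `Congruent s t`: some finite subterm-closed universe closes `s = t` (this is AC-congruence of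
binary trees, presented through finite universes). [cite: Krajicek1995, Def 13.3.1] -/
def Congruent (s t : FreeAddMagma α) : Prop :=
  ∃ Δ : Finset (FreeAddMagma α), Closes Δ s t

/-- The universe cost `U(s, t)`: the least cardinality of a subterm-closed finite universe within
which `s = t` is AC-derivable (`sInf` over `ℕ`; `0` iff no universe closes `s = t`) — the AC
analogue of Krajíček's measure `ℓ`, the least number of distinct subformulas in a proof.
[cite: Krajicek1995, Def 4.4.3 and Lemma 4.4.6 (the measure ℓ), adapted to the AC calculus] -/
noncomputable def minUniverse (s t : FreeAddMagma α) : ℕ :=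
  sInf {k | ∃ Δ : Finset (FreeAddMagma α), Δ.card = k ∧ Closes Δ s t}

variable {s t u : FreeAddMagma α}

/-- `Congruent` is reflexive (universe: the subterms of `s`). [cite: Krajicek1995, Def 13.3.1] -/
theorem Congruent.refl (s : FreeAddMagma α) : Congruent s s :=
  ⟨subterms s, subtermClosed_subterms s, .refl (self_mem_subterms s)⟩

/-- `Congruent` is symmetric. [cite: Krajicek1995, Def 13.3.1] -/
theorem Congruent.symm (h : Congruent s t) : Congruent t s := by
  obtain ⟨Δ, h₁, h₂⟩ := h
  exact ⟨Δ, h₁, h₂.symm⟩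

/-- `Congruent` is transitive (universe: the union). [cite: Krajicek1995, Def 13.3.1] -/
theorem Congruent.trans (h₁ : Congruent s t) (h₂ : Congruent t u) : Congruent s u := by
  obtain ⟨Δ₁, c₁, d₁⟩ := h₁
  obtain ⟨Δ₂, c₂, d₂⟩ := h₂
  exact ⟨Δ₁ ∪ Δ₂, c₁.union c₂,
    (d₁.mono Finset.subset_union_left).trans (d₂.mono Finset.subset_union_right)⟩

/-- Commutativity instances are congruences. [cite: Krajicek1995, Def 13.3.1] -/
theorem Congruent.comm (s t : FreeAddMagma α) : Congruent (s + t) (t + s) :=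
  ⟨subterms (s + t) ∪ subterms (t + s),
    (subtermClosed_subterms _).union (subtermClosed_subterms _),
    .comm (Finset.mem_union_left _ (self_mem_subterms _))
      (Finset.mem_union_right _ (self_mem_subterms _))⟩

/-- Associativity instances are congruences. [cite: Krajicek1995, Def 13.3.1] -/
theorem Congruent.assoc (s t u : FreeAddMagma α) : Congruent (s + t + u) (s + (t + u)) :=
  ⟨subterms (s + t + u) ∪ subterms (s + (t + u)),
    (subtermClosed_subterms _).union (subtermClosed_subterms _),
    .assoc (Finset.mem_union_left _ (self_mem_subterms _))
      (Finset.mem_union_right _ (self_mem_subterms _))⟩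

/-- `Congruent` is a congruence for `+` (universe: both universes plus the subterms of the two
compound sides). [cite: Krajicek1995, Def 13.3.1] -/
theorem Congruent.add {s₁ t₁ s₂ t₂ : FreeAddMagma α} (h₁ : Congruent s₁ t₁)
    (h₂ : Congruent s₂ t₂) : Congruent (s₁ + s₂) (t₁ + t₂) := by
  obtain ⟨Δ₁, c₁, d₁⟩ := h₁
  obtain ⟨Δ₂, c₂, d₂⟩ := h₂
  refine ⟨(Δ₁ ∪ Δ₂) ∪ (subterms (s₁ + s₂) ∪ subterms (t₁ + t₂)),
    (c₁.union c₂).union ((subtermClosed_subterms _).union (subtermClosed_subterms _)), ?_⟩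
  refine .cong (d₁.mono ?_) (d₂.mono ?_) ?_ ?_
  · exact Finset.subset_union_left.trans Finset.subset_union_left
  · exact Finset.subset_union_right.trans Finset.subset_union_left
  · exact Finset.mem_union_right _ (Finset.mem_union_left _ (self_mem_subterms _))
  · exact Finset.mem_union_right _ (Finset.mem_union_right _ (self_mem_subterms _))

/-- The universe cost is at most the cardinality of any closing universe. [cite: Krajicek1995, Def 4.4.3] -/
theorem minUniverse_le_card {Δ : Finset (FreeAddMagma α)} (h : Closes Δ s t) :
    minUniverse s t ≤ Δ.card :=
  Nat.sInf_le ⟨Δ, rfl, h⟩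

/-- For congruent terms the universe cost is attained by a closing universe (the `sInf` is a
minimum). [cite: Krajicek1995, Def 4.4.3] -/
theorem Congruent.exists_card_eq_minUniverse (h : Congruent s t) :
    ∃ Δ : Finset (FreeAddMagma α), Δ.card = minUniverse s t ∧ Closes Δ s t := by
  obtain ⟨Δ, hΔ⟩ := h
  exact Nat.sInf_mem (s := {k | ∃ Δ : Finset (FreeAddMagma α), Δ.card = k ∧ Closes Δ s t})
    ⟨Δ.card, Δ, rfl, hΔ⟩

end Universes

section Combs

variable [DecidableEq α]

/-- The right comb `a₁ + (a₂ + (⋯ + (a_k + z)))` over the leaf list `l = [a₁, …, a_k]` with terminal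
subtree `z`. [cite: PudlakBuss1995, §4 (permutation tautologies: re-bracketing a generic product)] -/
def comb (l : List α) (z : FreeAddMagma α) : FreeAddMagma α :=
  l.foldr (fun a t => FreeAddMagma.of a + t) z

omit [DecidableEq α] in
/-- Unfolding the comb of a cons. [cite: PudlakBuss1995, §4] -/
@[simp] theorem comb_cons (a : α) (l : List α) (z : FreeAddMagma α) :
    comb (a :: l) z = FreeAddMagma.of a + comb l z := rfl

omit [DecidableEq α] in
/-- The comb of the empty list is the terminal subtree. [cite: PudlakBuss1995, §4] -/
@[simp] theorem comb_nil (z : FreeAddMagma α) : comb ([] : List α) z = z := rfl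

omit [DecidableEq α] in
/-- Combs of concatenated lists nest. [cite: PudlakBuss1995, §4] -/
theorem comb_append (l₁ l₂ : List α) (z : FreeAddMagma α) :
    comb (l₁ ++ l₂) z = comb l₁ (comb l₂ z) := by
  simp [comb, List.foldr_append]

/-- Congruent terminal subtrees give congruent combs. [cite: Krajicek1995, Def 13.3.1] -/
theorem Congruent.comb_congr (l : List α) {z z' : FreeAddMagma α} (h : Congruent z z') :
    Congruent (comb l z) (comb l z') := by
  induction l with
  | nil => simpa using h
  | cons a l ih => simpa using (Congruent.refl (FreeAddMagma.of a)).add ih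

/-- Right combs over permuted leaf lists (same terminal subtree) are AC-congruent: the bubble
argument `b + (a + T) ~ (b + a) + T ~ (a + b) + T ~ a + (b + T)`.
[cite: PudlakBuss1995, §4 (rearranging a generic product by associativity/commutativity)] -/
theorem congruent_comb_of_perm {l₁ l₂ : List α} (h : l₁.Perm l₂) (z : FreeAddMagma α) :
    Congruent (comb l₁ z) (comb l₂ z) := by
  induction h with
  | nil => exact Congruent.refl z
  | cons a _ ih => simpa using (Congruent.refl (FreeAddMagma.of a)).add ih
  | swap a b l =>
    -- goal: comb (b :: a :: l) z ~ comb (a :: b :: l) z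
    simp only [comb_cons]
    exact ((Congruent.assoc (FreeAddMagma.of b) (FreeAddMagma.of a) (comb l z)).symm.trans
      (((Congruent.comm _ _).add (Congruent.refl _)))).trans (Congruent.assoc _ _ _)
  | trans _ _ ih₁ ih₂ => exact ih₁.trans ih₂

/-- Right combs whose full leaf sequences (list plus terminal leaf) are permutations of each other
are AC-congruent. [cite: PudlakBuss1995, §4] -/
theorem congruent_comb_of_perm_append {l₁ l₂ : List α} {a b : α}
    (h : (l₁ ++ [a]).Perm (l₂ ++ [b])) :
    Congruent (comb l₁ (FreeAddMagma.of a)) (comb l₂ (FreeAddMagma.of b)) := by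
  by_cases hab : a = b
  · subst hab
    exact congruent_comb_of_perm ((List.perm_append_right_iff _).mp h) _
  · -- `a` occurs in `l₂`; move it to the end of `l₂`, swap it with `b`, and permute the rest.
    have ha : a ∈ l₂ := by
      have : a ∈ l₂ ++ [b] := h.subset (List.mem_append_right _ (List.mem_singleton_self a))
      simpa [hab] using this
    obtain ⟨u, v, rfl⟩ := List.append_of_mem ha
    have h₁ : (u ++ a :: v).Perm (u ++ v ++ [a]) := by
      refine List.perm_middle.trans ?_
      simpa using (List.perm_append_singleton a (u ++ v)).symm
    have h₂ : l₁.Perm (u ++ v ++ [b]) := by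
      have X : ((u ++ v ++ [a]) ++ [b]).Perm ((u ++ v ++ [b]) ++ [a]) := by
        simpa using (List.Perm.swap b a []).append_left (u ++ v)
      exact (List.perm_append_right_iff _).mp (h.trans ((h₁.append_right [b]).trans X))
    refine (congruent_comb_of_perm h₂ _).trans ?_
    -- comb (u ++ v ++ [b]) (of a) = comb (u ++ v) (of b + of a) ~ comb (u ++ v) (of a + of b)
    --   = comb (u ++ v ++ [a]) (of b) ~ comb (u ++ a :: v) (of b)
    rw [comb_append, comb_cons, comb_nil]
    refine (Congruent.comb_congr (u ++ v) (Congruent.comm _ _)).trans ?_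
    have e : comb (u ++ v ++ [a]) (FreeAddMagma.of b)
        = comb (u ++ v) (FreeAddMagma.of a + FreeAddMagma.of b) := by
      rw [comb_append, comb_cons, comb_nil]
    rw [← e]
    exact (congruent_comb_of_perm h₁ _).symm

variable {n : ℕ}

/-- The right comb `x_{π 0} + (x_{π 1} + (⋯ + x_{π n}))` of a permutation `π` of `Fin (n + 1)`
(for `π = 1` the generic sum `x₀ + (x₁ + (⋯ + x_n))`; Orevkov's / Pudlák–Buss's permuted generic
product, for one binary symbol). [cite: PudlakBuss1995, §4 (permutation tautologies)] -/
def combPerm (π : Equiv.Perm (Fin (n + 1))) : FreeAddMagma (Fin (n + 1)) :=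
  comb (List.ofFn fun i : Fin n => π (Fin.castSucc i)) (FreeAddMagma.of (π (Fin.last n)))

/-- The AC-REARRANGEMENT UNIVERSE `U_AC(π)` of a permutation `π` of `Fin (n + 1)`: the least
number of distinct terms in a subterm-closed universe within which the pure AC calculus derives
`x₀ + (x₁ + (⋯ + x_n)) = x_{π 0} + (x_{π 1} + (⋯ + x_{π n}))` — the universe cost (`minUniverse`,
Krajíček's `ℓ` for the AC calculus) of re-bracketing the generic sum into the order `π`.
[cite: Krajicek1995, Def 4.4.3 / Def 13.3.1 (ℓ and ⊢_Γ), for the AC calculus on PudlakBuss1995 §4 rearrangements] -/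
noncomputable def acUniverse (π : Equiv.Perm (Fin (n + 1))) : ℕ :=
  minUniverse (combPerm 1) (combPerm π)

/-- Every permuted comb is AC-congruent to the generic one: closing universes exist.
[cite: PudlakBuss1995, §4] -/
theorem congruent_combPerm (π : Equiv.Perm (Fin (n + 1))) :
    Congruent (combPerm 1) (combPerm π) := by
  refine congruent_comb_of_perm_append ?_
  have e : ∀ ρ : Equiv.Perm (Fin (n + 1)),
      (List.ofFn fun i : Fin n => ρ (Fin.castSucc i)) ++ [ρ (Fin.last n)] = List.ofFn ρ := by
    intro ρ
    rw [List.ofFn_succ']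
    simp
  rw [e, e]
  have h := Equiv.Perm.ofFn_comp_perm π (fun i : Fin (n + 1) => i)
  simp only [Function.comp_def] at h
  simpa using h.symm

/-- `U_AC(π)` is attained: some subterm-closed universe of cardinality exactly `acUniverse π`
closes the rearrangement (so the `sInf` defining it is a minimum, never the junk value).
[cite: Krajicek1995, Def 4.4.3] -/
theorem exists_card_eq_acUniverse (π : Equiv.Perm (Fin (n + 1))) :
    ∃ Δ : Finset (FreeAddMagma (Fin (n + 1))),
      Δ.card = acUniverse π ∧ Closes Δ (combPerm 1) (combPerm π) :=
  (congruent_combPerm π).exists_card_eq_minUniverse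

/-- `U_AC(π)` is at most the cardinality of any universe closing the rearrangement.
[cite: Krajicek1995, Def 4.4.3] -/
theorem acUniverse_le_card {π : Equiv.Perm (Fin (n + 1))} {Δ : Finset (FreeAddMagma (Fin (n + 1)))}
    (h : Closes Δ (combPerm 1) (combPerm π)) : acUniverse π ≤ Δ.card :=
  minUniverse_le_card h

/-- `U_AC(π)` is positive (a closing universe contains the generic comb). [cite: Krajicek1995, Def 4.4.3] -/
theorem acUniverse_pos (π : Equiv.Perm (Fin (n + 1))) : 0 < acUniverse π := by
  obtain ⟨Δ, hcard, _, hd⟩ := exists_card_eq_acUniverse π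
  rw [← hcard]
  exact Finset.card_pos.mpr ⟨_, hd.mem.1⟩

end Combs

end ACRewriting

end Literature.Computability.MetaComplexity
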